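import Summits.Schanuel.Schanuel.Theorems.RootDecomp1KXAll05

/-!
# RootDecomp1KXAll — lens 1, generation 46, node 5 «ALL CURVES: ThinFibreAt m₀ P for EVERY P ∈ ℤ[x][Y], P ≠ 0, at every m₀ ≥ thinThreshold P = max(3, 2·μ(P)+1, e(P)+1)» (CLAIM L2336, PRICE + CHECKLIST K-g46 L2337, NODE L2353, critic VERDICT L2357: CLEARED THEOREM ×1 under K-R35 — the last threshold-THEOREM of the K-line, UNCONDITIONAL; PORT GO L2357) — continuation (RootDecomp1KXAll06): §XIV.8 (second half) members P₁ P₂ P₃ and the consumer at the members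

(lens-1 g46 HOME kernel K₅ = HOME/decomp-schanuel-lens-1/g46/XAll.lean 4f432885…, 1310 l, ONE import …RootDecomp1KXTop03; P₅/C₅ + NODE-g46.md. Port by census-1 gen 20 as `RootDecomp1KXAll01–06` (the memo's 01–05 split with §XIV.8 cut in two by the 400-line cap): 01 = private helper copies + §XIV.1 roots with multiplicity in `ℂ₂` and the nearest-root lemma without separability (`roots_data_mult`, `nearest_root_mult`, `rootMultiplicity_le_one_of_separable`, `rootMultiplicity_le_natDegree'`) + §XIV.2 Ridout for rationals with exponent `κ = a/b > 2` (`ridout_one_pow`, `ridout_window_pow`; tree `Ridout.finite_of_abs_le_one` BY NAME, called once); 02 = §XIV.3 the dichotomy with multiplicity (`near_root_or_at_infinity_mult`) + §XIV.4 its arithmetic end (`dichotomy_arith_mult`); 03 = §XIV.5 THE PARAMETRIC THEOREM `thinFibreAt_xPoly_mult` (+ `_claim`, `_again` private, `_crude`) + §XIV.6 every `P ∈ ℤ[x][Y]` (`xCoeff`, `topX`, `eTop`, `muTop`, `thinThreshold`, `xPolyP_xCoeff`, **`thinFibreAt_all`**, `thinFibreAt_effective`); 04 = §XIV.7 CONSUMER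 for all x-degrees (`xCoeff_dX`, …, `thinThreshold_dX_le`, `no_relation_of_closed_class`, `allCurves_nonvanishing`); 05 = §XIV.8 thresholds of `xPolyP k c` in the data `(μ, e)`, specialisations BY NAME (examples against tree `…XTop.thinFibreAt_xPoly`, `…XLinearII.thinFibreAt_xLinear_sep`, `ridout_window`, `dichotomy_arith`), root-multiplicity bounds, the P₃-family `thinFibreAt_purePowerTop`; 06 = members P₁ P₂ P₃ with thresholds 5 / 7 / 5 proved as theorems + CONSUMER at the members.
PORT EDITS (sanctioned in VERDICT L2357 (a)–(e)): `set_option linter.dupNamespace false` dropped; `thinFibreAt_xPoly_again` and `thinFibreAt_xLinear_sep_again` (type-twins of tree `…XTop.thinFibreAt_xPoly` / `…XLinearII.thinFibreAt_xLinear_sep`) made `private` (dedup); per-part private helper copies; the two scoped `set_option maxHeartbeats 400000 in` kept as in K₅; `example` blocks kept; 19 one-line docstrings added (gate lint.docstring); statements and proofs otherwise verbatim. `--supports stmt-Schanuel-33364`; no census credit carried; rung 0 — nothing here proves Schanuel; no ∀-item of 1K moves.)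
-/

noncomputable section

namespace Summit.Schanuel.Schanuel.Theorems.RootDecomp1KXAll

open Polynomial LiouvilleNumber
open scoped Nat
open Summit.Schanuel.Schanuel.Theorems.RootDecomp1KSkelCell
  (exists_le_two_pow_factorial iota iota_spec iota_le_of_le pow_lt_of_lt_iota lt_iota_of_pow_lt iota_mono
   one_le_iota SkelLiouville SkelLiouvilleFix skelLiouville_iff_fix SkelLiouvilleFix.mono uStar dU rU dU_cast
   two_pow_le_four_mul_dU two_mul_dU_lt one_le_dU rU_den rU_cast uStar_sub_rU skelLiouvilleFix_one_uStar
   not_skelFixOne_algebraicIndependent)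
open Summit.Schanuel.Schanuel.Theorems.RootDecomp1KTwoBaseCell (psNumer partialSum_eq_psNumer_div coprime_psNumer
  algebraicIndependent_of_forall_int')
open Summit.Schanuel.Schanuel.Theorems.RootDecomp1KRelLiouvilleCell (partialSum_two_strictMono
  partialSum_two_lt_liouvilleNumber abs_liouvilleNumber_two_sub_partialSum)
open Summit.Schanuel.Schanuel.Theorems.RootDecomp1KDegreeLadder
open Summit.Schanuel.Schanuel.Theorems.RootDecomp1KXLinearCore
open Summit.Schanuel.Schanuel.Theorems.RootDecomp1KXLinear
open Summit.Schanuel.Schanuel.Theorems.RootDecomp1KXLinearII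
open Summit.Schanuel.Schanuel.Theorems.RootDecomp1KXTop

/-! ### MEMBER P₁ = `x²·(Y−1)²(Y+1) + x·(Y³+Y+1) + (Y⁵−2)`: `k = 2`, `μ = 2`, `e = 2`, threshold `5`
(top `(Y−1)²(Y+1)` NOT separable ⇒ refused by node 4's `hsep`; `k = 2` ⇒ outside nodes 2–3; free regime needs
`m₀ ≥ deg_Y + 1 = 6`). -/

/-- the `x`-coefficients of `P₁` -/
def memberC₁ : ℕ → ℤ[X]
  | 0 => X ^ 5 - C 2
  | 1 => X ^ 3 + X + 1
  | _ => (X - C 1) ^ 2 * (X + 1)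

/-- The top coefficient of member P₁: `(Y − 1)²(Y + 1)`. -/
theorem memberC₁_two : memberC₁ 2 = (X - C 1) ^ 2 * (X + 1) := rfl

/-- The top coefficient of member P₁ is non-zero. -/
theorem memberC₁_top_ne_zero : memberC₁ 2 ≠ 0 := by
  rw [memberC₁_two]
  exact mul_ne_zero (pow_ne_zero _ (X_sub_C_ne_zero 1)) (X_add_C_ne_zero 1)

/-- The top coefficient of member P₁ has degree `3`. -/
theorem natDegree_memberC₁_top : (memberC₁ 2).natDegree = 3 := by
  rw [memberC₁_two]
  compute_degree!

/-- every root of `(Y−1)²(Y+1)` in `ℂ₂` has multiplicity `≤ 2`. -/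
theorem rootMultiplicity_memberC₁_top (β : PadicAlgCl 2) :
    rootMultiplicity β ((memberC₁ 2).map (algebraMap ℤ (PadicAlgCl 2))) ≤ 2 := by
  classical
  have hmap : (memberC₁ 2).map (algebraMap ℤ (PadicAlgCl 2)) = (X - C 1) * (X - C 1) * (X - C (-1)) := by
    rw [memberC₁_two, Polynomial.map_mul, Polynomial.map_pow, Polynomial.map_sub, Polynomial.map_add, map_X,
      map_C, Polynomial.map_one, map_one, pow_two, map_neg, C_1, sub_neg_eq_add]
  have h1 : (X - C (1 : PadicAlgCl 2)) ≠ 0 := X_sub_C_ne_zero _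
  have h2 : (X - C (-1 : PadicAlgCl 2)) ≠ 0 := X_sub_C_ne_zero _
  rw [hmap, rootMultiplicity_mul (mul_ne_zero (mul_ne_zero h1 h1) h2), rootMultiplicity_mul (mul_ne_zero h1 h1),
    rootMultiplicity_X_sub_C, rootMultiplicity_X_sub_C]
  have hne : (1 : PadicAlgCl 2) ≠ -1 := by
    intro h
    have : (2 : PadicAlgCl 2) = 0 := by linear_combination h
    exact two_ne_zero this
  split_ifs with h1 h2 <;> first | omega | exact absurd (h1.symm.trans h2) hne

/-- the top coefficient of `P₁` is NOT separable over `ℚ` (so node 4 does not apply). -/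
theorem memberC₁_top_not_separable : ¬ ((memberC₁ 2).map (Int.castRingHom ℚ)).Separable := by
  intro hsep
  have hmap : (memberC₁ 2).map (Int.castRingHom ℚ) = (X - C 1) * (X - C 1) * (X + 1) := by
    rw [memberC₁_two, Polynomial.map_mul, Polynomial.map_pow, Polynomial.map_sub, Polynomial.map_add, map_X,
      map_C, Polynomial.map_one, pow_two]
    simp
  have hsq := hsep.squarefree (X - C 1) (by rw [hmap]; exact Dvd.intro (X + 1) rfl)
  exact not_isUnit_X_sub_C (1 : ℚ) hsq

/-- **P₁**: `ThinFibreAt m₀ (x²·(Y−1)²(Y+1) + x·(Y³+Y+1) + (Y⁵−2))` for every `m₀ ≥ 5`. -/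
theorem thinFibreAt_member₁ {m₀ : ℕ} (hm : 5 ≤ m₀) : ThinFibreAt m₀ (xPolyP 2 memberC₁) := by
  refine thinFibreAt_xPoly_mult 2 memberC₁ 2 2 memberC₁_top_ne_zero (by norm_num) rootMultiplicity_memberC₁_top
    (fun j hj => ?_) (by omega) (by omega)
  rw [natDegree_memberC₁_top]
  interval_cases j
  · show (X ^ 5 - C 2 : ℤ[X]).natDegree ≤ 3 + 2
    rw [natDegree_X_pow_sub_C]
  · show (X ^ 3 + X + 1 : ℤ[X]).natDegree ≤ 3 + 2
    compute_degree!

/-- the threshold of `P₁` EVALUATED: `thinThreshold P₁ ≤ 5` (from the explicit factorisation of the top). -/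
theorem thinThreshold_member₁ : thinThreshold (xPolyP 2 memberC₁) ≤ 5 := by
  refine (thinThreshold_xPolyP_le 2 memberC₁ 2 2 memberC₁_top_ne_zero rootMultiplicity_memberC₁_top
    (fun j hj => ?_)).trans (by norm_num)
  rw [natDegree_memberC₁_top]
  interval_cases j
  · show (X ^ 5 - C 2 : ℤ[X]).natDegree ≤ 3 + 2
    rw [natDegree_X_pow_sub_C]
  · show (X ^ 3 + X + 1 : ℤ[X]).natDegree ≤ 3 + 2
    compute_degree!

example {m₀ : ℕ} (hm : 5 ≤ m₀) : ThinFibreAt m₀ (xPolyP 2 memberC₁) :=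
  thinFibreAt_all _ (by
    intro h0
    have := topX_xPolyP 2 memberC₁ memberC₁_top_ne_zero
    rw [h0] at this
    exact memberC₁_top_ne_zero (by rw [← this]; unfold topX xCoeff; simp)) (thinThreshold_member₁.trans hm)

/-! ### MEMBER P₂ = `x³·2(Y²+1)³ + x·Y + (Y⁷+3)`: `k = 3`, top `2(Y²+1)³` (irreducible quadratic, cubed), `μ = 3`,
`e = 1`, threshold `7` (free regime: `8`). -/

/-- the `x`-coefficients of `P₂` -/
def memberC₂ : ℕ → ℤ[X]
  | 0 => X ^ 7 + C 3
  | 1 => X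
  | 2 => 0
  | _ => C 2 * (X ^ 2 + 1) ^ 3

/-- The top coefficient of member P₂: `2(Y² + 1)³`. -/
theorem memberC₂_three : memberC₂ 3 = C 2 * (X ^ 2 + 1) ^ 3 := rfl

/-- `Y² + 1 ≠ 0` in `ℤ[Y]`. -/
private theorem X_sq_add_one_ne_zero : (X ^ 2 + 1 : ℤ[X]) ≠ 0 := by
  rw [← C_1]; exact X_pow_add_C_ne_zero (by norm_num) 1

/-- The top coefficient of member P₂ is non-zero. -/
theorem memberC₂_top_ne_zero : memberC₂ 3 ≠ 0 := by
  rw [memberC₂_three]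
  exact mul_ne_zero (C_ne_zero.mpr (by norm_num)) (pow_ne_zero _ X_sq_add_one_ne_zero)

/-- The top coefficient of member P₂ has degree `6`. -/
theorem natDegree_memberC₂_top : (memberC₂ 3).natDegree = 6 := by
  rw [memberC₂_three, natDegree_C_mul (by norm_num), natDegree_pow, ← C_1, natDegree_X_pow_add_C]

/-- every root of `2(Y²+1)³` in `ℂ₂` has multiplicity `≤ 3` (`Y² + 1` is separable in characteristic `0`). -/
theorem rootMultiplicity_memberC₂_top (β : PadicAlgCl 2) :
    rootMultiplicity β ((memberC₂ 3).map (algebraMap ℤ (PadicAlgCl 2))) ≤ 3 := by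
  have hmap : (memberC₂ 3).map (algebraMap ℤ (PadicAlgCl 2)) = C 2 * (X ^ 2 - C (-1)) ^ 3 := by
    rw [memberC₂_three, Polynomial.map_mul, map_C, Polynomial.map_pow, Polynomial.map_add, Polynomial.map_pow,
      map_X, Polynomial.map_one, map_neg, C_1, sub_neg_eq_add]
    simp
  have hsep : (X ^ 2 - C (-1 : PadicAlgCl 2)).Separable :=
    separable_X_pow_sub_C (-1 : PadicAlgCl 2) (by norm_num) (by norm_num)
  rw [hmap, rootMultiplicity_C_mul_eq 2 two_ne_zero]
  exact rootMultiplicity_pow_le_of_separable _ hsep 3 β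

/-- **P₂**: every `m₀ ≥ 7`. -/
theorem thinFibreAt_member₂ {m₀ : ℕ} (hm : 7 ≤ m₀) : ThinFibreAt m₀ (xPolyP 3 memberC₂) := by
  refine thinFibreAt_xPoly_mult 3 memberC₂ 1 3 memberC₂_top_ne_zero (by norm_num) rootMultiplicity_memberC₂_top
    (fun j hj => ?_) (by omega) (by omega)
  rw [natDegree_memberC₂_top]
  interval_cases j
  · show (X ^ 7 + C 3 : ℤ[X]).natDegree ≤ 6 + 1
    rw [natDegree_X_pow_add_C]
  · show (X : ℤ[X]).natDegree ≤ 6 + 1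
    rw [natDegree_X]; norm_num
  · show (0 : ℤ[X]).natDegree ≤ 6 + 1
    rw [natDegree_zero]; norm_num

/-- `thinThreshold P₂ ≤ 7`. -/
theorem thinThreshold_member₂ : thinThreshold (xPolyP 3 memberC₂) ≤ 7 := by
  refine (thinThreshold_xPolyP_le 3 memberC₂ 1 3 memberC₂_top_ne_zero rootMultiplicity_memberC₂_top
    (fun j hj => ?_)).trans (by norm_num)
  rw [natDegree_memberC₂_top]
  interval_cases j
  · show (X ^ 7 + C 3 : ℤ[X]).natDegree ≤ 6 + 1
    rw [natDegree_X_pow_add_C]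
  · show (X : ℤ[X]).natDegree ≤ 6 + 1
    rw [natDegree_X]; norm_num
  · show (0 : ℤ[X]).natDegree ≤ 6 + 1
    rw [natDegree_zero]; norm_num

/-! ### MEMBER P₃ = `x²·(Y−3)² + x·Y⁵ + (Y⁶+1)`: pure-power top `(Y−3)²`, `μ = 2`, `e = 4`, threshold `5`
(free regime: `7`; node 4 refused: top not separable). -/

/-- the `x`-coefficients of `P₃` -/
def memberC₃ : ℕ → ℤ[X]
  | 0 => X ^ 6 + 1
  | 1 => X ^ 5
  | _ => (X - C 3) ^ 2

/-- **P₃**: every `m₀ ≥ 5`, by the pure-power family theorem. -/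
theorem thinFibreAt_member₃ {m₀ : ℕ} (hm : 5 ≤ m₀) : ThinFibreAt m₀ (xPolyP 2 memberC₃) := by
  refine thinFibreAt_purePowerTop 2 memberC₃ 3 2 4 (by norm_num) rfl (fun j hj => ?_) (by omega) (by omega)
  interval_cases j
  · show (X ^ 6 + 1 : ℤ[X]).natDegree ≤ 2 + 4
    rw [← C_1, natDegree_X_pow_add_C]
  · show (X ^ 5 : ℤ[X]).natDegree ≤ 2 + 4
    rw [natDegree_X_pow]; norm_num

/-- `thinThreshold P₃ ≤ 5`. -/
theorem thinThreshold_member₃ : thinThreshold (xPolyP 2 memberC₃) ≤ 5 := by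
  have hB : memberC₃ 2 ≠ 0 := pow_ne_zero _ (X_sub_C_ne_zero 3)
  have hd : (memberC₃ 2).natDegree = 2 := by
    show ((X - C 3) ^ 2 : ℤ[X]).natDegree = 2
    rw [natDegree_pow, natDegree_X_sub_C, mul_one]
  refine (thinThreshold_xPolyP_le 2 memberC₃ 4 2 hB (fun β => ?_) (fun j hj => ?_)).trans (by norm_num)
  · show rootMultiplicity β (((X - C 3) ^ 2 : ℤ[X]).map (algebraMap ℤ (PadicAlgCl 2))) ≤ 2
    rw [Polynomial.map_pow, Polynomial.map_sub, map_X, map_C]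
    exact rootMultiplicity_X_sub_C_pow_le _ 2 β
  · rw [hd]
    interval_cases j
    · show (X ^ 6 + 1 : ℤ[X]).natDegree ≤ 2 + 4
      rw [← C_1, natDegree_X_pow_add_C]
    · show (X ^ 5 : ℤ[X]).natDegree ≤ 2 + 4
      rw [natDegree_X_pow]; norm_num

/-- the pure-power top of `P₃` is not separable either. -/
theorem memberC₃_top_not_separable : ¬ ((memberC₃ 2).map (Int.castRingHom ℚ)).Separable := by
  intro hsep
  have hsq := hsep.squarefree (X - C 3) (by
    show (X - C (3 : ℚ)) * (X - C 3) ∣ ((X - C 3) ^ 2 : ℤ[X]).map (Int.castRingHom ℚ)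
    rw [Polynomial.map_pow, Polynomial.map_sub, map_X, map_C, pow_two]
    simp)
  exact not_isUnit_X_sub_C (3 : ℚ) hsq

/-! ### CONSUMER at the members -/

/-- for `ρ ∈ Skel₍m₎`, `m ≥ 5`: `P₁(ℓ₂, ρ) ≠ 0` and `P₃(ℓ₂, ρ) ≠ 0`; `m ≥ 7`: `P₂(ℓ₂, ρ) ≠ 0`. -/
theorem member₁_nonvanishing {m : ℕ} {ρ : ℝ} (hρ : SkelLiouvilleFix m ρ) (hm : 5 ≤ m) :
    bev (xPolyP 2 memberC₁) (liouvilleNumber 2) ρ ≠ 0 :=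
  allCurves_nonvanishing hρ _ (by
    intro h0
    have := topX_xPolyP 2 memberC₁ memberC₁_top_ne_zero
    rw [h0] at this
    exact memberC₁_top_ne_zero (by rw [← this]; unfold topX xCoeff; simp)) (thinThreshold_member₁.trans hm)

/-- CONSUMER at member P₂: `P₂(ℓ₂, ρ) ≠ 0` for `ρ ∈ SkelLiouvilleFix m`, `m ≥ 7`. -/
theorem member₂_nonvanishing {m : ℕ} {ρ : ℝ} (hρ : SkelLiouvilleFix m ρ) (hm : 7 ≤ m) :
    bev (xPolyP 3 memberC₂) (liouvilleNumber 2) ρ ≠ 0 :=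
  allCurves_nonvanishing hρ _ (by
    intro h0
    have := topX_xPolyP 3 memberC₂ memberC₂_top_ne_zero
    rw [h0] at this
    exact memberC₂_top_ne_zero (by rw [← this]; unfold topX xCoeff; simp)) (thinThreshold_member₂.trans hm)

end Summit.Schanuel.Schanuel.Theorems.RootDecomp1KXAll

end
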